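import Summits.RiemannHypothesis.RiemannHypothesis.Theorems.WeilCombCombShapeAdmissible
import Summits.RiemannHypothesis.RiemannHypothesis.Theorems.WeilCombCombShapePositivityBumpCellBounds
import Literature.NumberTheory.LFunctions.WeilExplicit
import Literature.NumberTheory.LFunctions.WeilExplicitProofs
import Literature.NumberTheory.LFunctions.WeilMellinBounds

/-!
# Stubs `bumpTransform_decay`, `bumpTransform_sq_eq`, `bumpAutocorr_pos` (plan T2, "bump toolkit")
for crux `WeilComb.CombShapePositivity`
(item stmt-RiemannHypothesis-11229, route route-RiemannHypothesis-WeilComb, line `Sketch`,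
stub-plan `Cruxes/CombShapePositivity/STUB-PLAN-stub_fejer.md`, tier T2 "dilation detection")

Notation (written out in every statement, no new definitions): the route's fixed bump
`φ₀(u) = expNegInvGlue (1 − u²)` (smooth, even, `≥ 0`, support `[−1, 1]`; a Weil test by
`weilComb_shapeBump_isWeilTest`), its entire transform `Φ₀(z) = ∫ φ₀(u) e^{zu} du` and its
autocorrelation `ψ₀(t) = ∫ φ₀(u) φ₀(t − u) du = (φ₀ ⋆ φ₀)(t)`.  Tier T2 of the plan (the lead's
`stub_dilationDetection`) reads the zero side of `Q(φ_ε)`, `φ_ε = ε⁻¹ φ₀(·/ε)`, as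
`Σ_ρ m(ρ) Φ₀(ε(ρ − ½))²` and needs exactly the three registered facts proved here:

* `bumpTransform_decay`: `‖Φ₀(z)‖ ≤ C e^{|Re z|} / (1 + ‖z‖²)`.  Proof: `Φ₀(z) = φ̂₀(½ + z)`
  (`weilMellin`), and `(φ₀'')^(½ + z) = z² φ̂₀(½ + z)` (`weilMellin_deriv_deriv`, two integrations by
  parts); both `φ₀` and `φ₀''` live on `[−1, 1]` where `|e^{zu}| = e^{Re z · u} ≤ e^{|Re z|}`, so
  `‖Φ₀(z)‖ ≤ ‖φ₀‖₁ e^{|Re z|}` and `‖z‖² ‖Φ₀(z)‖ ≤ ‖φ₀''‖₁ e^{|Re z|}`; `C = ‖φ₀‖₁ + ‖φ₀''‖₁`.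
* `bumpTransform_sq_eq`: `Φ₀(z)² = ∫_{−2}^{2} ψ₀(t) e^{zt} dt`.  Proof: transform of a convolution is
  the product of transforms (`weilMellin_weilConv_holds`), `weilConv φ₀ φ₀ = ψ₀` (`weilConv_apply`,
  `integral_complex_ofReal`), and `ψ₀` vanishes for `|t| ≥ 2` so the whole-line integral is the
  integral over `(−2, 2]`.
* `bumpAutocorr_pos`: `ψ₀ > 0` on `(−2, 2)`: the integrand `u ↦ φ₀(u) φ₀(t − u)` is continuous,
  `≥ 0`, compactly supported and positive at `u = t/2`
  (`Continuous.integral_pos_of_hasCompactSupport_nonneg_nonzero`).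

Extras for the lead (same written-out expressions): `bumpTransform_eq_weilMellin`,
`bumpTransform_neg` (`Φ₀(−z) = Φ₀(z)`), `conj_bumpTransform` (`conj Φ₀(z) = Φ₀(conj z)`),
`continuous_bumpAutocorr`, `bumpAutocorr_nonneg`, `bumpAutocorr_eq_zero` (`ψ₀(t) = 0` for
`2 ≤ |t|`), `bumpAutocorr_even`.  Everything is elementary real analysis; nothing is specific to
`ζ`.  (The tree file `…ArchDiagBombieriBoundsK2` treats the same autocorrelation in the convention
`P₀(s) = ∫ φ₀(u) φ₀(u − s) du`; here the plan's convention `φ₀(t − u)` is kept verbatim.)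
-/

noncomputable section

-- the sub-problem path RiemannHypothesis/RiemannHypothesis duplicates a namespace (D-0017)
set_option linter.dupNamespace false

open scoped BigOperators ComplexConjugate Real Topology
open Complex MeasureTheory Set Filter

namespace Summit.RiemannHypothesis.RiemannHypothesis.Theorems.WeilCombBohrFejer

open Literature.NumberTheory.LFunctions

/-! ## The real bump `φ₀(u) = expNegInvGlue (1 − u²)` -/

-- Reused from the tree: `continuous_shapeBump` (`…BumpCellBounds.lean`).

/-- `φ₀(u) = 0` for `1 ≤ |u|` (`expNegInvGlue` vanishes on `(−∞, 0]`). [folklore] -/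
theorem shapeBump_eq_zero_of_one_le_abs {u : ℝ} (hu : 1 ≤ |u|) : expNegInvGlue (1 - u ^ 2) = 0 := by
  have h : 1 ≤ u ^ 2 := (one_le_sq_iff_one_le_abs u).2 hu
  exact expNegInvGlue.zero_of_nonpos (by linarith)

/-- `support φ₀ ⊆ [−1, 1]` (private copy of `support_bumpR_subset_diagBB` of
`…ArchDiagBombieriBoundsK2.lean`, whose import is avoided here). [folklore] -/
private theorem support_shapeBumpR_subset :
    Function.support (fun u : ℝ => expNegInvGlue (1 - u ^ 2)) ⊆ Icc (-1) 1 := by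
  intro u hu
  by_contra h
  refine hu (shapeBump_eq_zero_of_one_le_abs ?_)
  simp only [mem_Icc, not_and_or, not_le] at h
  rcases h with h | h
  · exact le_abs.2 (Or.inr (by linarith))
  · exact le_abs.2 (Or.inl h.le)

/-- `φ₀` has compact support (private copy of `hasCompactSupport_bumpR_diagBB`). [folklore] -/
private theorem hasCompactSupport_shapeBumpR :
    HasCompactSupport fun u : ℝ => expNegInvGlue (1 - u ^ 2) :=
  HasCompactSupport.of_support_subset_isCompact isCompact_Icc support_shapeBumpR_subset

/-! ## The autocorrelation `ψ₀(t) = ∫ φ₀(u) φ₀(t − u) du` -/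

/-- `ψ₀(t) = 0` for `2 ≤ |t|`: if `φ₀(u) ≠ 0` then `|u| < 1`, so `|t − u| > 1` and
`φ₀(t − u) = 0`. [folklore] -/
theorem bumpAutocorr_eq_zero {t : ℝ} (ht : 2 ≤ |t|) :
    ∫ u : ℝ, expNegInvGlue (1 - u ^ 2) * expNegInvGlue (1 - (t - u) ^ 2) = 0 := by
  have h : (fun u : ℝ => expNegInvGlue (1 - u ^ 2) * expNegInvGlue (1 - (t - u) ^ 2)) =
      fun _ => 0 := by
    funext u
    rcases le_or_gt 1 |u| with hu | hu
    · rw [shapeBump_eq_zero_of_one_le_abs hu, zero_mul]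
    · have htu : 1 ≤ |t - u| := by
        have := abs_sub_abs_le_abs_sub t u
        linarith
      rw [shapeBump_eq_zero_of_one_le_abs htu, mul_zero]
  rw [h, integral_zero]

/-- `ψ₀ ≥ 0` (the integrand is `≥ 0`). [folklore] -/
theorem bumpAutocorr_nonneg (t : ℝ) :
    0 ≤ ∫ u : ℝ, expNegInvGlue (1 - u ^ 2) * expNegInvGlue (1 - (t - u) ^ 2) :=
  integral_nonneg fun _ => mul_nonneg (expNegInvGlue.nonneg _) (expNegInvGlue.nonneg _)

/-- `ψ₀` is even: `ψ₀(−t) = ψ₀(t)` (substitute `u ↦ −u`; `φ₀` is even). [folklore] -/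
theorem bumpAutocorr_even (t : ℝ) :
    ∫ u : ℝ, expNegInvGlue (1 - u ^ 2) * expNegInvGlue (1 - (-t - u) ^ 2) =
      ∫ u : ℝ, expNegInvGlue (1 - u ^ 2) * expNegInvGlue (1 - (t - u) ^ 2) := by
  have h := integral_neg_eq_self
    (fun u : ℝ => expNegInvGlue (1 - u ^ 2) * expNegInvGlue (1 - (t - u) ^ 2)) volume
  beta_reduce at h
  rw [← h]
  congr 1 with u
  ring_nf

/-- `ψ₀` is continuous: it is the convolution `φ₀ ⋆ φ₀` of a continuous compactly supported
function with itself (`HasCompactSupport.continuous_convolution_right`). [folklore] -/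
theorem continuous_bumpAutocorr :
    Continuous fun t : ℝ =>
      ∫ u : ℝ, expNegInvGlue (1 - u ^ 2) * expNegInvGlue (1 - (t - u) ^ 2) := by
  refine (hasCompactSupport_shapeBumpR.continuous_convolution_right (ContinuousLinearMap.mul ℝ ℝ)
    (continuous_shapeBump.locallyIntegrable (μ := volume)) continuous_shapeBump).congr
    fun t => ?_
  exact convolution_mul

/-- **T2 `bumpAutocorr_pos`** (registered stub of crux stmt-RiemannHypothesis-11229, plan tier T2):
`ψ₀(t) > 0` for `|t| < 2`.  The integrand `u ↦ φ₀(u) φ₀(t − u)` is continuous, `≥ 0`, compactly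
supported and positive at `u = t/2` (there both factors are `φ₀(t/2) > 0` as `1 − (t/2)² > 0`).
[folklore] -/
theorem bumpAutocorr_pos : ∀ t : ℝ, t ∈ Set.Ioo (-2 : ℝ) 2 →
    0 < ∫ u : ℝ, expNegInvGlue (1 - u ^ 2) * expNegInvGlue (1 - (t - u) ^ 2) := by
  intro t ht
  have hc : Continuous fun u : ℝ =>
      expNegInvGlue (1 - u ^ 2) * expNegInvGlue (1 - (t - u) ^ 2) :=
    continuous_shapeBump.mul
      ((expNegInvGlue.contDiff (n := 0)).continuous.comp
        (by fun_prop : Continuous fun u : ℝ => 1 - (t - u) ^ 2))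
  have hsupp : HasCompactSupport fun u : ℝ =>
      expNegInvGlue (1 - u ^ 2) * expNegInvGlue (1 - (t - u) ^ 2) :=
    hasCompactSupport_shapeBumpR.mul_right
  have hnn : 0 ≤ fun u : ℝ => expNegInvGlue (1 - u ^ 2) * expNegInvGlue (1 - (t - u) ^ 2) := by
    intro u
    simp only [Pi.zero_apply]
    exact mul_nonneg (expNegInvGlue.nonneg _) (expNegInvGlue.nonneg _)
  have h0 : (fun u : ℝ => expNegInvGlue (1 - u ^ 2) * expNegInvGlue (1 - (t - u) ^ 2)) (t / 2)
      ≠ 0 := by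
    have h1 : 0 < 1 - (t / 2) ^ 2 := by nlinarith [ht.1, ht.2]
    have h2 : 0 < 1 - (t - t / 2) ^ 2 := by nlinarith [ht.1, ht.2]
    exact (mul_pos (expNegInvGlue.pos_of_pos h1) (expNegInvGlue.pos_of_pos h2)).ne'
  exact hc.integral_pos_of_hasCompactSupport_nonneg_nonzero hsupp hnn h0

/-! ## The transform `Φ₀(z) = ∫ φ₀(u) e^{zu} du` -/

/-- `∫ h(t) e^{zt} dt = ĥ(½ + z)`, the Weil transform `weilMellin h` at `½ + z`. [folklore] -/
theorem integral_mul_cexp_eq_weilMellin (h : ℝ → ℂ) (z : ℂ) :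
    ∫ t : ℝ, h t * cexp (z * t) = weilMellin h (1 / 2 + z) := by
  unfold weilMellin
  congr 1 with t
  rw [add_sub_cancel_left]

/-- `Φ₀(z) = φ̂₀(½ + z)` with `φ̂₀ = weilMellin φ₀`. [folklore] -/
theorem bumpTransform_eq_weilMellin (z : ℂ) :
    ∫ u : ℝ, ((expNegInvGlue (1 - u ^ 2) : ℝ) : ℂ) * Complex.exp (z * u) =
      weilMellin (fun u : ℝ => ((expNegInvGlue (1 - u ^ 2) : ℝ) : ℂ)) (1 / 2 + z) :=
  integral_mul_cexp_eq_weilMellin _ z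

/-- `Φ₀` is even: `Φ₀(−z) = Φ₀(z)` (substitute `u ↦ −u`; `φ₀` is even). [folklore] -/
theorem bumpTransform_neg (z : ℂ) :
    ∫ u : ℝ, ((expNegInvGlue (1 - u ^ 2) : ℝ) : ℂ) * Complex.exp (-z * u) =
      ∫ u : ℝ, ((expNegInvGlue (1 - u ^ 2) : ℝ) : ℂ) * Complex.exp (z * u) := by
  have h := integral_neg_eq_self
    (fun u : ℝ => ((expNegInvGlue (1 - u ^ 2) : ℝ) : ℂ) * Complex.exp (z * u)) volume
  beta_reduce at h
  rw [← h]
  congr 1 with u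
  push_cast
  ring_nf

/-- `Φ₀` is real on real data: `conj Φ₀(z) = Φ₀(conj z)` (`φ₀` is real-valued;
`integral_conj`). [folklore] -/
theorem conj_bumpTransform (z : ℂ) :
    conj (∫ u : ℝ, ((expNegInvGlue (1 - u ^ 2) : ℝ) : ℂ) * Complex.exp (z * u)) =
      ∫ u : ℝ, ((expNegInvGlue (1 - u ^ 2) : ℝ) : ℂ) * Complex.exp (conj z * u) := by
  rw [← integral_conj]
  congr 1 with u
  rw [map_mul, ← Complex.exp_conj, map_mul, Complex.conj_ofReal, Complex.conj_ofReal]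

/-- For continuous `h` vanishing off `[−1, 1]`: `‖∫ h(t) e^{zt} dt‖ ≤ (∫ ‖h‖) e^{|Re z|}`, since
`|e^{zt}| = e^{Re z · t} ≤ e^{|Re z|}` for `|t| ≤ 1`. [folklore] -/
theorem norm_integral_mul_cexp_le {h : ℝ → ℂ} (hc : Continuous h)
    (hs : Function.support h ⊆ Icc (-1) 1) (z : ℂ) :
    ‖∫ t : ℝ, h t * cexp (z * t)‖ ≤ (∫ t : ℝ, ‖h t‖) * Real.exp |z.re| := by
  have hcs : HasCompactSupport h := HasCompactSupport.of_support_subset_isCompact isCompact_Icc hs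
  rw [← integral_mul_const]
  refine norm_integral_le_of_norm_le
    ((hc.norm.mul continuous_const).integrable_of_hasCompactSupport hcs.norm.mul_right)
    (Eventually.of_forall fun t => ?_)
  rw [norm_mul, Complex.norm_exp]
  by_cases ht : h t = 0
  · simp [ht]
  · have hmem : t ∈ Icc (-1 : ℝ) 1 := hs (Function.mem_support.2 ht)
    refine mul_le_mul_of_nonneg_left (Real.exp_le_exp.2 ?_) (norm_nonneg _)
    have hre : (z * (t : ℂ)).re = z.re * t := by simp [Complex.mul_re]
    rw [hre]
    calc z.re * t ≤ |z.re * t| := le_abs_self _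
      _ = |z.re| * |t| := abs_mul _ _
      _ ≤ |z.re| * 1 := by gcongr; exact abs_le.2 ⟨hmem.1, hmem.2⟩
      _ = |z.re| := mul_one _

/-- Decay for a Weil test `h` with `tsupport h ⊆ [−1, 1]`:
`‖∫ h e^{zt}‖ (1 + ‖z‖²) ≤ (∫ ‖h‖ + ∫ ‖h''‖) e^{|Re z|}` (the bound for `h` plus the bound for
`h''`, whose transform is `z²` times that of `h` by two integrations by parts,
`weilMellin_deriv_deriv`). [folklore] -/
theorem norm_integral_mul_cexp_mul_le {h : ℝ → ℂ} (hh : IsWeilTest h)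
    (hs : tsupport h ⊆ Icc (-1) 1) (z : ℂ) :
    ‖∫ t : ℝ, h t * cexp (z * t)‖ * (1 + ‖z‖ ^ 2) ≤
      ((∫ t : ℝ, ‖h t‖) + ∫ t : ℝ, ‖deriv (deriv h) t‖) * Real.exp |z.re| := by
  have h1 := norm_integral_mul_cexp_le hh.1.continuous ((subset_tsupport _).trans hs) z
  have h2 := norm_integral_mul_cexp_le hh.deriv.deriv.1.continuous
    ((subset_tsupport _).trans (tsupport_deriv_subset.trans (tsupport_deriv_subset.trans hs))) z
  rw [integral_mul_cexp_eq_weilMellin, weilMellin_deriv_deriv hh,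
    ← integral_mul_cexp_eq_weilMellin, add_sub_cancel_left, norm_mul, norm_pow] at h2
  calc ‖∫ t : ℝ, h t * cexp (z * t)‖ * (1 + ‖z‖ ^ 2)
      = ‖∫ t : ℝ, h t * cexp (z * t)‖ + ‖z‖ ^ 2 * ‖∫ t : ℝ, h t * cexp (z * t)‖ := by ring
    _ ≤ (∫ t : ℝ, ‖h t‖) * Real.exp |z.re| +
          (∫ t : ℝ, ‖deriv (deriv h) t‖) * Real.exp |z.re| := add_le_add h1 h2
    _ = ((∫ t : ℝ, ‖h t‖) + ∫ t : ℝ, ‖deriv (deriv h) t‖) * Real.exp |z.re| := by ring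

/-- **T2 `bumpTransform_decay`** (registered stub of crux stmt-RiemannHypothesis-11229, plan tier
T2): `‖Φ₀(z)‖ ≤ C e^{|Re z|} / (1 + ‖z‖²)` for all `z : ℂ`, with
`C = ∫ ‖φ₀‖ + ∫ ‖φ₀''‖` (two integrations by parts, support `[−1, 1]`). [folklore] -/
theorem bumpTransform_decay : ∃ C : ℝ, ∀ z : ℂ,
    ‖∫ u : ℝ, ((expNegInvGlue (1 - u ^ 2) : ℝ) : ℂ) * Complex.exp (z * u)‖ ≤
      C * Real.exp |z.re| / (1 + ‖z‖ ^ 2) := by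
  refine ⟨(∫ t : ℝ, ‖((expNegInvGlue (1 - t ^ 2) : ℝ) : ℂ)‖) +
    ∫ t : ℝ, ‖deriv (deriv fun u : ℝ => ((expNegInvGlue (1 - u ^ 2) : ℝ) : ℂ)) t‖, fun z => ?_⟩
  rw [le_div_iff₀ (by positivity)]
  exact norm_integral_mul_cexp_mul_le weilComb_shapeBump_isWeilTest
    weilComb_shapeBump_tsupport_subset z

/-- **T2 `bumpTransform_sq_eq`** (registered stub of crux stmt-RiemannHypothesis-11229, plan tier
T2): `Φ₀(z)² = ∫_{−2}^{2} ψ₀(t) e^{zt} dt` — the transform of the convolution `φ₀ ⋆ φ₀ = ψ₀` is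
the product of the transforms (`weilMellin_weilConv_holds`), and `ψ₀` vanishes off `(−2, 2]`
(`bumpAutocorr_eq_zero`). [folklore] -/
theorem bumpTransform_sq_eq : ∀ z : ℂ,
    (∫ u : ℝ, ((expNegInvGlue (1 - u ^ 2) : ℝ) : ℂ) * Complex.exp (z * u)) ^ 2 =
      ∫ t in (-2 : ℝ)..2, ((∫ u : ℝ, expNegInvGlue (1 - u ^ 2) *
        expNegInvGlue (1 - (t - u) ^ 2) : ℝ) : ℂ) * Complex.exp (z * t) := by
  intro z
  have hg : IsWeilTest (fun u : ℝ => ((expNegInvGlue (1 - u ^ 2) : ℝ) : ℂ)) :=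
    weilComb_shapeBump_isWeilTest
  have hconv : ∀ t : ℝ, weilConv (fun u : ℝ => ((expNegInvGlue (1 - u ^ 2) : ℝ) : ℂ))
      (fun u : ℝ => ((expNegInvGlue (1 - u ^ 2) : ℝ) : ℂ)) t =
      ((∫ u : ℝ, expNegInvGlue (1 - u ^ 2) * expNegInvGlue (1 - (t - u) ^ 2) : ℝ) : ℂ) := by
    intro t
    rw [weilConv_apply, ← integral_complex_ofReal]
    simp only [Complex.ofReal_mul]
  rw [sq, integral_mul_cexp_eq_weilMellin,
    ← weilMellin_weilConv_holds hg.1.continuous hg.2 hg.1.continuous hg.2,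
    ← integral_mul_cexp_eq_weilMellin]
  simp_rw [hconv]
  rw [intervalIntegral.integral_of_le (by norm_num : (-2 : ℝ) ≤ 2)]
  refine (setIntegral_eq_integral_of_forall_compl_eq_zero fun t ht => ?_).symm
  have h2 : 2 ≤ |t| := by
    simp only [mem_Ioc, not_and_or, not_lt, not_le] at ht
    rcases ht with h | h
    · exact le_abs.2 (Or.inr (by linarith))
    · exact le_abs.2 (Or.inl h.le)
  rw [bumpAutocorr_eq_zero h2, Complex.ofReal_zero, zero_mul]

end Summit.RiemannHypothesis.RiemannHypothesis.Theorems.WeilCombBohrFejer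

end
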